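import Mathlib
import HarnessLib

/-!
# Cyclic runs of a proper subset of `Fin 6` (helper, line `eight_fifths_primitive`)

Helper sub-goal (wave 4, S7 assembly) of `stub_noBranching : NoFoldBound → NoBranching` of line
`eight_fifths_primitive`, crux `QCIdentification` (stmt-CriticalPhenomena-16772); namespace of the
checked skeleton, sub-namespace `NB`. Pure finite combinatorics, no lattice vocabulary.

**What.** At a boundary site `s` of the source component `Λ₀` of a hexagonal domain, the set
`J = {j : Fin 6 | face s j ∈ Λ₀}` of hexagon faces present is a PROPER subset of the cyclic index set
`Fin 6 = ℤ/6`; it is the disjoint union of its maximal cyclic runs ("arcs")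
`j + 1, j + 2, …, j + m` (`j ∉ J` the *pre-flank*, `m = runLen J j ∈ {1, …, 5}` the run length,
`j + 1 + m ∉ J` the *post-flank*). This file provides the bookkeeping the combinatorial Gauss–Bonnet
count needs, all decided by enumeration of the `64` subsets:

* `runStarts J = {j | j ∉ J ∧ j + 1 ∈ J}` and `runLen J j` (first exit after `j + 1`);
  for `j ∈ runStarts J`: `runLen J j ≠ 0`, `j + 1 + i ∈ J` for `i < runLen J j`
  (`mem_of_lt_runLen`), `j + runLen J j ∈ J` (`add_runLen_mem`) and, if `J ≠ univ`,
  `j + 1 + runLen J j ∉ J` (`add_one_add_runLen_not_mem`);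
* **run decomposition** (registered `s7_sum_runs`): for `J ≠ univ` and any `g : Fin 6 → M`,
  `Σ_{j ∈ J} g j = Σ_{j ∈ runStarts J} Σ_{i < runLen J j} g (j + 1 + i)`;
* re-indexing the runs by their first element (`sum_runStarts_eq_sum_first`:
  `l = j + 1 ∈ J`, `l - 1 ∉ J`) and by their last element (`sum_runStarts_eq_sum_last`:
  `l = j + runLen J j ∈ J`, `l + 1 ∉ J`), the two bijections behind the telescoping of the flank
  windings along the boundary;
* `card_filter_lt`: `#{i : Fin 6 | i < m} = m`.

Sources: folklore (maximal runs of a cyclic 0/1 word); the stub report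
`STUB-REPORT-noBranching.md` of this line (§2, S4/S7).
-/

namespace Summit.CriticalPhenomena.SAWScalingLimit.Cruxes.QCIdentification.EightFifthsPrimitive

namespace NB

/-! ## Runs -/

/-- The pre-flanks of the runs of `J`: indices `j ∉ J` with `j + 1 ∈ J`. -/
def runStarts (J : Finset (Fin 6)) : Finset (Fin 6) :=
  Finset.univ.filter fun j => j ∉ J ∧ j + 1 ∈ J

/-- The length of the run of `J` starting at `j + 1` (meaningful for `j ∈ runStarts J`,
`J ≠ univ`): the least `m ≥ 1` with `j + 1 + m ∉ J`, capped at `5`. -/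
def runLen (J : Finset (Fin 6)) (j : Fin 6) : Fin 6 :=
  if j + 2 ∉ J then 1 else if j + 3 ∉ J then 2 else if j + 4 ∉ J then 3 else
    if j + 5 ∉ J then 4 else 5

/-- The (pre-flank, offset) pairs `(j, i)`, `j ∈ runStarts J`, `i < runLen J j`, enumerating the
elements `j + 1 + i` of `J` run by run. -/
def runPairs (J : Finset (Fin 6)) : Finset (Fin 6 × Fin 6) :=
  (Finset.univ ×ˢ Finset.univ).filter fun p => p.1 ∈ runStarts J ∧ p.2 < runLen J p.1

/-- Membership in `runStarts`. -/
@[simp] theorem mem_runStarts {J : Finset (Fin 6)} {j : Fin 6} :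
    j ∈ runStarts J ↔ j ∉ J ∧ j + 1 ∈ J := by
  simp [runStarts]

/-- Run lengths are positive. -/
theorem runLen_ne_zero (J : Finset (Fin 6)) (j : Fin 6) : runLen J j ≠ 0 := by
  unfold runLen
  split_ifs <;> decide

/-- The elements of a run lie in `J`. -/
theorem mem_of_lt_runLen : ∀ (J : Finset (Fin 6)), ∀ j ∈ runStarts J, ∀ i : Fin 6,
    i < runLen J j → j + 1 + i ∈ J := by
  decide

/-- The last element `j + runLen J j` of a run lies in `J`. -/
theorem add_runLen_mem : ∀ (J : Finset (Fin 6)), ∀ j ∈ runStarts J, j + runLen J j ∈ J := by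
  decide

/-- The post-flank `j + 1 + runLen J j` of a run of a proper subset lies outside `J`. -/
theorem add_one_add_runLen_not_mem : ∀ (J : Finset (Fin 6)), J ≠ Finset.univ →
    ∀ j ∈ runStarts J, j + 1 + runLen J j ∉ J := by
  decide

/-- The runs of a proper subset cover it: `{j + 1 + i | (j, i) ∈ runPairs J} = J`. -/
theorem image_runPairs : ∀ (J : Finset (Fin 6)), J ≠ Finset.univ →
    (runPairs J).image (fun p => p.1 + 1 + p.2) = J := by
  decide

/-- The runs are disjoint and simple: a proper subset has as many elements as run positions. -/
theorem card_runPairs : ∀ (J : Finset (Fin 6)), J ≠ Finset.univ → (runPairs J).card = J.card := by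
  decide

/-- Hence `(j, i) ↦ j + 1 + i` is injective on `runPairs J` (`J` proper). -/
theorem injOn_runPairs (J : Finset (Fin 6)) (hJ : J ≠ Finset.univ) :
    Set.InjOn (fun p : Fin 6 × Fin 6 => p.1 + 1 + p.2) ↑(runPairs J) :=
  Finset.card_image_iff.1 (by rw [image_runPairs J hJ, card_runPairs J hJ])

/-- **Run decomposition (registered).** A sum over a proper subset `J` of `Fin 6` is the sum over
its maximal cyclic runs: `Σ_{j ∈ J} g j = Σ_{j ∈ runStarts J} Σ_{i < runLen J j} g (j + 1 + i)`. -/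
theorem s7_sum_runs : ∀ {M : Type*} [AddCommMonoid M] (J : Finset (Fin 6)), J ≠ Finset.univ → ∀ g : Fin 6 → M, ∑ j ∈ J, g j = ∑ j ∈ runStarts J, ∑ i ∈ Finset.univ.filter (fun i : Fin 6 => i < runLen J j), g (j + 1 + i) := by
  intro M _ J hJ g
  calc ∑ j ∈ J, g j
      = ∑ j ∈ (runPairs J).image (fun p => p.1 + 1 + p.2), g j := by rw [image_runPairs J hJ]
    _ = ∑ p ∈ runPairs J, g (p.1 + 1 + p.2) := Finset.sum_image (injOn_runPairs J hJ)
    _ = ∑ j ∈ runStarts J, ∑ i ∈ Finset.univ.filter (fun i : Fin 6 => i < runLen J j),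
          g (j + 1 + i) :=
        Finset.sum_finset_product' (runPairs J) (runStarts J)
          (fun j => Finset.univ.filter (fun i : Fin 6 => i < runLen J j))
          (f := fun j i => g (j + 1 + i)) (fun p => by simp [runPairs])

/-! ## Re-indexing the runs by their first and last elements -/

/-- The first elements of the runs: `runStarts J + 1 = {l ∈ J | l - 1 ∉ J}`. -/
theorem image_runStarts_add_one : ∀ (J : Finset (Fin 6)),
    (runStarts J).image (fun j => j + 1) = J.filter (fun l => l - 1 ∉ J) := by
  decide

/-- The last elements of the runs of a proper subset:
`{j + runLen J j | j ∈ runStarts J} = {l ∈ J | l + 1 ∉ J}`. -/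
theorem image_runStarts_add_runLen : ∀ (J : Finset (Fin 6)), J ≠ Finset.univ →
    (runStarts J).image (fun j => j + runLen J j) = J.filter (fun l => l + 1 ∉ J) := by
  decide

/-- Distinct runs have distinct last elements. -/
theorem injOn_add_runLen : ∀ (J : Finset (Fin 6)), ∀ j ∈ runStarts J, ∀ j' ∈ runStarts J,
    j + runLen J j = j' + runLen J j' → j = j' := by
  decide

/-- **Runs indexed by their first element.** For `h : Fin 6 → M`,
`Σ_{j ∈ runStarts J} h j = Σ_{l ∈ J, l - 1 ∉ J} h (l - 1)`. -/
theorem sum_runStarts_eq_sum_first {M : Type*} [AddCommMonoid M] (J : Finset (Fin 6))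
    (h : Fin 6 → M) :
    ∑ j ∈ runStarts J, h j = ∑ l ∈ J.filter (fun l => l - 1 ∉ J), h (l - 1) := by
  have hinj : Set.InjOn (fun j : Fin 6 => j + 1) ↑(runStarts J) :=
    fun p _ q _ h => by simpa using h
  rw [← image_runStarts_add_one J, Finset.sum_image hinj]
  simp

/-- **Runs of a proper subset indexed by their last element.** For `h : Fin 6 → M`,
`Σ_{j ∈ runStarts J} h (j + runLen J j) = Σ_{l ∈ J, l + 1 ∉ J} h l`. -/
theorem sum_runStarts_eq_sum_last {M : Type*} [AddCommMonoid M] (J : Finset (Fin 6))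
    (hJ : J ≠ Finset.univ) (h : Fin 6 → M) :
    ∑ j ∈ runStarts J, h (j + runLen J j) = ∑ l ∈ J.filter (fun l => l + 1 ∉ J), h l := by
  have hinj : Set.InjOn (fun j : Fin 6 => j + runLen J j) ↑(runStarts J) :=
    fun p hp q hq h => injOn_add_runLen J p hp q hq h
  rw [← image_runStarts_add_runLen J hJ, Finset.sum_image hinj]

/-- `#{i : Fin 6 | i < m} = m`. -/
theorem card_filter_lt (m : Fin 6) :
    (Finset.univ.filter (fun i : Fin 6 => i < m)).card = (m : ℕ) := by
  rw [Finset.filter_gt_eq_Iio, Fin.card_Iio]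

end NB

end Summit.CriticalPhenomena.SAWScalingLimit.Cruxes.QCIdentification.EightFifthsPrimitive
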